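import Summits.QuantumFields.YangMills.Theorems.BalabanStepParabolic.Negative.OverTunedContinuity
import Summits.QuantumFields.YangMills.Theorems.BalabanStepParabolic.Negative.ThinChartReduction
import Literature.MathematicalPhysics.QuantumFieldTheory.BalabanRegulatorChart
import HarnessLib

/-!
# `BalabanStepParabolic` — negative-side support: the over-tuned thin inhabitant (the crux's structure is
# inhabited modulo an RG-free "uniform over-tuned triviality" of Wilson's lattice gauge theory)

Support file for crux `stmt-QuantumFields-9684` (`ParabolicTrajectory.BalabanStepParabolic`), line
`perfect-action-regulator-chart`, drefute gen 2 (stub-misstated finding, note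
`Cruxes/BalabanStepParabolic/DREFUTE2-stub_regulatorChartOdd.md`). Companion of `Negative/OverTunedLimit.lean`
(every inhabitant at odd `M` FORCES over-tuned triviality); here the CONVERSE:

**`nonempty_of_uniformOverTuned`**: for odd `M ≥ 2`, any compact `G`, any `r : LatticeRep G` and any `B > 0`,
if the genuine centred curvature `(m+1)`-point Wilson functions on the tori `M^k(2L+1)` with `k`-fold
block-dilated off-diagonal test functions (unit normalisation, exact centring) satisfy
`∀ B' ε > 0, ∃ k₀, ∀ k ≥ k₀, ∀ β ≥ B·k − B', |W| ≤ ε` (uniformly small in the over-tuned weak-coupling regime),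
then `Nonempty (BalabanBanachStep G r M)`.

The inhabitant is the disprover's THIN junk chart (`ThinChartReduction.nonempty_of_thinChartFunctional`:
`E = ℝ²`, `φ g = g + (log M) g³`, `Ψ = y/2`, `yW g = (1, g)`, `betaOf = κ/g²` with `κ = B/log M`, normalisations
`cInd`) with an EXPLICIT CONTINUOUS germ on base tori (§4 `germC`): shell weight `Λ(s)` (§3: the fibre
coordinate `s = 2^{-k}` of a junk Wilson orbit encodes the depth; `kIdx` recovers it exactly via `Nat.find`,
no logarithms) × orbit localiser `ζ(x − φ^k(γ))` × transported data `E_k(γ) = W(κ/γ²)` of the decoded coupling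
`γ = clamp(w/s)`. (4a) holds identically (`orbitRec`), (4b) by exact decoding on the orbits (`expectC_wilson`),
and (4c) — the crux's entire content — reduces (§5 `continuous_germMain`) to: finite-torus `β`-continuity and
`β → ∞` decay (landed, `TorusRegularity`), dilation invariance of `⁰𝒮` (§1), a parabolic counting lemma for the
junk flow (§2: an orbit that has not passed `T` after `k` steps started at `1/γ² ≥ b(k − N_T)`, i.e. is
OVER-TUNED), and the hypothesis, used only at the accumulation plane `s = 0` of the Wilson orbits.
No Banach space of actions, no renormalisation-group step, no regulator, no `b₀` enters: together with
`OverTunedLimit.overtuned_trivial_of_nonempty` this identifies the content of the typed crux at odd `M` with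
over-tuned triviality (see the note for the planner-level repair: pin `κ b₀` and add non-triviality).
**`nonempty_regulatorChart_of_uniformOverTuned`**: the same thin data inhabit the LINE's object
`RegulatorChart G r M` (smooth half-chart normal form `smoothHalfChart_thin₂` on `ℝ × ℝ`), so the line's stub
`stub_regulatorChartOdd` asks for no more than over-tuned triviality either.
-/

namespace Summit.QuantumFields.YangMills.Theorems.BalabanStepParabolic.Negative

open scoped SchwartzMap
open MeasureTheory Filter Topology
open Literature.MathematicalPhysics.QuantumFieldTheory Literature.MathematicalPhysics.AQFT
open Literature.MathematicalPhysics.QuantumLattice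

noncomputable section

/-! ### §1 Off-diagonality is dilation invariant -/

section OffDiag

variable {n : ℕ}

/-- Composing every test function of a tuple with the dilation `x ↦ c • x` (`c ≠ 0`) preserves
off-diagonality of the tensor product: `⁰𝒮` is dilation invariant. [folklore] -/
theorem isOffDiagonal_tensorFin_dilate (f : Fin n → 𝓢(EuclideanSpace ℝ (Fin 4), ℝ)) (c : ℝ)
    (L : 𝓢(EuclideanSpace ℝ (Fin 4), ℝ) →L[ℝ] 𝓢(EuclideanSpace ℝ (Fin 4), ℝ))
    (hL : ∀ (φ : 𝓢(EuclideanSpace ℝ (Fin 4), ℝ)) (x : EuclideanSpace ℝ (Fin 4)), L φ x = φ (c • x))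
    (hf : IsOffDiagonal (SchwartzMap.tensorFin n fun i => ofRealTest (f i))) :
    IsOffDiagonal (SchwartzMap.tensorFin n fun i => ofRealTest (L (f i))) := by
  intro x hx k
  set g : (Fin n → EuclideanSpace ℝ (Fin 4)) →L[ℝ] (Fin n → EuclideanSpace ℝ (Fin 4)) :=
    c • ContinuousLinearMap.id ℝ _ with hg
  have hfun : ((SchwartzMap.tensorFin n fun i => ofRealTest (L (f i))) :
      (Fin n → EuclideanSpace ℝ (Fin 4)) → ℂ) =
      ((SchwartzMap.tensorFin n fun i => ofRealTest (f i)) : (Fin n → EuclideanSpace ℝ (Fin 4)) → ℂ) ∘ g := by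
    funext y
    simp [hL, hg]
  have hgx : g x ∈ coincidenceLocus n (EuclideanSpace ℝ (Fin 4)) := by
    obtain ⟨i, j, hij, hxij⟩ := hx
    exact ⟨i, j, hij, by simp [hg, hxij]⟩
  have hsmooth : ContDiff ℝ k ((SchwartzMap.tensorFin n fun i => ofRealTest (f i)) :
      (Fin n → EuclideanSpace ℝ (Fin 4)) → ℂ) := SchwartzMap.smooth _ k
  rw [hfun, g.iteratedFDeriv_comp_right hsmooth x le_rfl, hf (g x) hgx k]
  ext v
  simp

/-- Block dilation preserves off-diagonality. [folklore] -/
theorem isOffDiagonal_blockDilate {M : ℕ} (hM : M ≠ 0) (f : Fin n → 𝓢(EuclideanSpace ℝ (Fin 4), ℝ))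
    (hf : IsOffDiagonal (SchwartzMap.tensorFin n fun i => ofRealTest (f i))) :
    IsOffDiagonal (SchwartzMap.tensorFin n fun i => ofRealTest (blockDilate M (f i))) :=
  isOffDiagonal_tensorFin_dilate f ((M : ℝ)⁻¹) (blockDilate M) (fun φ x => blockDilate_apply hM φ x) hf

/-- Block contraction preserves off-diagonality. [folklore] -/
theorem isOffDiagonal_blockContract {M : ℕ} (hM : M ≠ 0) (f : Fin n → 𝓢(EuclideanSpace ℝ (Fin 4), ℝ))
    (hf : IsOffDiagonal (SchwartzMap.tensorFin n fun i => ofRealTest (f i))) :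
    IsOffDiagonal (SchwartzMap.tensorFin n fun i => ofRealTest (blockContract M (f i))) :=
  isOffDiagonal_tensorFin_dilate f (M : ℝ) (blockContract M) (fun φ x => blockContract_apply hM φ x) hf

/-- Iterated block dilation preserves off-diagonality. [folklore] -/
theorem isOffDiagonal_blockDilate_iterate {M : ℕ} (hM : M ≠ 0) (k : ℕ)
    (f : Fin n → 𝓢(EuclideanSpace ℝ (Fin 4), ℝ))
    (hf : IsOffDiagonal (SchwartzMap.tensorFin n fun i => ofRealTest (f i))) :
    IsOffDiagonal (SchwartzMap.tensorFin n fun i => ofRealTest ((blockDilate M)^[k] (f i))) := by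
  induction k with
  | zero => simpa using hf
  | succ k ih =>
    have := isOffDiagonal_blockDilate hM (fun i => (blockDilate M)^[k] (f i)) ih
    simpa only [Function.iterate_succ_apply'] using this

/-- Tuple contraction preserves off-diagonality. [folklore] -/
theorem isOffDiagonal_contractTuple {M : ℕ} (hM : M ≠ 0) (f : Fin n → 𝓢(EuclideanSpace ℝ (Fin 4), ℝ))
    (hf : IsOffDiagonal (SchwartzMap.tensorFin n fun i => ofRealTest (f i))) :
    IsOffDiagonal (SchwartzMap.tensorFin n fun i => ofRealTest (contractTuple M f i)) :=
  isOffDiagonal_blockContract hM f hf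

end OffDiag

/-! ### §6 The over-tuned thin inhabitant -/

section Inhabitant

/-- **Orbit recursion preserves continuity along an invariant class of test data** (variant of
`continuous_orbitRec` in which the germ is only known to be continuous for data satisfying a predicate
stable under the pull-back `T`). [folklore] -/
theorem continuous_orbitRec_of {P α β : Type} (Mb : ℕ) (F : P → P) (T : α → α) (e : P → ℕ → α → β)
    (hMb : 2 ≤ Mb) [TopologicalSpace P] [TopologicalSpace β] (hF : Continuous F) (Q : α → Prop)
    (hQ : ∀ a, Q a → Q (T a)) (he : ∀ S a, Q a → Continuous fun p => e p S a) (S : ℕ) (a : α) (ha : Q a) :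
    Continuous fun p => orbitRec Mb F T e hMb p S a := by
  induction S using Nat.strong_induction_on generalizing a with
  | _ S ih =>
    by_cases h : S ≠ 0 ∧ Mb ∣ S
    · obtain ⟨S', rfl⟩ := h.2
      have hS' : S' ≠ 0 := by rintro rfl; exact h.1 (by simp)
      have hlt : S' < Mb * S' := by
        have : 1 * S' < Mb * S' := Nat.mul_lt_mul_of_pos_right (by omega) (Nat.pos_of_ne_zero hS')
        simpa using this
      simp_rw [orbitRec_mul F T e hMb _ hS']
      exact (ih S' hlt (T a) (hQ a ha)).comp hF
    · simp_rw [orbitRec_of_not F T e hMb _ S _ h]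
      exact he S a ha

variable {G : Type} [Group G] [TopologicalSpace G] [IsTopologicalGroup G] [CompactSpace G]
  [MeasurableSpace G] [BorelSpace G] (r : LatticeRep G) (M : ℕ)

/-- **(4c) for the over-tuned functional.** Under uniform over-tuned triviality at slope `B`, the functional
`expectC` with dictionary constant `κ = B / log M` is continuous in the chart point for every torus, every species
string and every OFF-DIAGONAL tuple (orbit recursion along the dilation-invariant class `⁰𝒮` over the continuous
germ). [folklore] -/
theorem continuous_expectC (hM : 2 ≤ M) {B : ℝ} (hB : 0 < B)
    (hUOT : ∀ (B' : ℝ) (L m : ℕ) (h : Fin (m + 1) → 𝓢(EuclideanSpace ℝ (Fin 4), ℝ)),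
      IsOffDiagonal (SchwartzMap.tensorFin (m + 1) fun i => ofRealTest (h i)) →
      ∀ ε > 0, ∃ k₀ : ℕ, ∀ k ≥ k₀, ∀ β : ℝ, B * k - B' ≤ β →
        |wilsonCentredSchwinger r.ρ β ((M ^ k * (2 * L + 1) - 1) / 2) (fun _ => 1) (m + 1)
          (fun _ => r.curvature) (fun i => (blockDilate M)^[k] (h i))| ≤ ε)
    (n : ℕ) (σ : Fin n → YMSpecies G) (S : ℕ) (f : Fin n → 𝓢(EuclideanSpace ℝ (Fin 4), ℝ))
    (hf : IsOffDiagonal (SchwartzMap.tensorFin n fun i => ofRealTest (f i))) :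
    Continuous fun p => expectC r M (B / Real.log M) hM n σ p S f := by
  have hlog : 0 < Real.log M := Real.log_pos (by exact_mod_cast hM)
  have hκ : 0 < B / Real.log M := div_pos hB hlog
  have hBκ : B / Real.log M * Real.log M = B := by field_simp
  have hM0 : M ≠ 0 := by omega
  refine continuous_orbitRec_of M (FJ M) (contractTuple M) (germC r M (B / Real.log M) n σ) hM
    (continuous_FJ M) (fun a => IsOffDiagonal (SchwartzMap.tensorFin n fun i => ofRealTest (a i)))
    (fun a ha => isOffDiagonal_contractTuple hM0 a ha) (fun S₀ a ha => ?_) S f hf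
  refine continuous_germC r M (B / Real.log M) hM hκ n σ S₀ a (fun hn hodd B' ε hε => ?_)
  obtain ⟨L, rfl⟩ := hodd
  obtain ⟨m, rfl⟩ := Nat.exists_eq_succ_of_ne_zero hn
  obtain ⟨k₀, hk₀⟩ := hUOT B' L m a ha ε hε
  refine ⟨k₀, fun k hk β hβ => ?_⟩
  have hβ' : B * k - B' ≤ β := by rwa [hBκ] at hβ
  exact hk₀ k hk β hβ'

/-- **The over-tuned thin inhabitant.** For ODD `M ≥ 2` (hence `≥ 3`), ANY compact `G` and lattice
representation `r`: if for some slope constant `B > 0` the genuine centred curvature `n`-point Wilson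
functions (`n ≥ 1`, unit normalisation, exact centring) on the tori of side `M^k(2L+1)`, smeared with
`k`-fold block-dilated OFF-DIAGONAL test functions, tend to `0` as `k → ∞` UNIFORMLY over all inverse
couplings `β ≥ B k − B'` (every `B'`) — "uniform over-tuned triviality", an RG-free statement about Wilson's
lattice gauge theory in the deep weak-coupling / small-physical-volume regime — then the crux's structure
`BalabanBanachStep G r M` is inhabited: by the disprover's thin junk chart `ℝ × ℝ²` (`φ g = g + (log M) g³`,
`Ψ = y/2`, `yW g = (1, g)`, `betaOf g = κ/g²` with `κ = B / log M`, normalisations `cInd`) carrying the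
CONTINUOUS germ `germC` (shell weight × orbit localiser × transported Wilson data); (4a) by `orbitRec`, (4b)
by decoding `(k, g)` on the junk Wilson orbits, (4c) by `continuous_expectC` — whose only non-elementary input
at the accumulation plane `s = 0` of the Wilson orbits is the hypothesis. No Banach space of actions, no
renormalisation-group step, no `b₀`, no regulator is involved. [folklore] -/
theorem nonempty_of_uniformOverTuned (hMo : Odd M) (hM : 2 ≤ M) {B : ℝ} (hB : 0 < B)
    (hUOT : ∀ (B' : ℝ) (L m : ℕ) (h : Fin (m + 1) → 𝓢(EuclideanSpace ℝ (Fin 4), ℝ)),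
      IsOffDiagonal (SchwartzMap.tensorFin (m + 1) fun i => ofRealTest (h i)) →
      ∀ ε > 0, ∃ k₀ : ℕ, ∀ k ≥ k₀, ∀ β : ℝ, B * k - B' ≤ β →
        |wilsonCentredSchwinger r.ρ β ((M ^ k * (2 * L + 1) - 1) / 2) (fun _ => 1) (m + 1)
          (fun _ => r.curvature) (fun i => (blockDilate M)^[k] (h i))| ≤ ε) :
    Nonempty (BalabanBanachStep G r M) := by
  have hlog : 0 < Real.log M := Real.log_pos (by exact_mod_cast hM)
  have hκ : 0 < B / Real.log M := div_pos hB hlog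
  refine nonempty_of_thinChartFunctional r M hM hlog hκ (fun _ => cInd r) (fun _ => cInd_curvature r)
    (fun p S n σ f => expectC r M (B / Real.log M) hM n σ p S f) ?_ ?_ ?_
  · intro p S n σ f _ _
    exact expectC_step r M _ hM n σ p S f
  · intro g hg L n σ f
    exact expectC_wilson r M _ hM hMo n σ hg L f
  · intro S n σ f hf
    exact (continuous_expectC r M hM hB hUOT n σ S f hf).continuousOn

/-- The thin maps on the chart `ℝ × ℝ` carry the exact smooth half-chart normal form of the line
`perfect-action-regulator-chart` (`C = 1`, `b = 1 · log M`, `δ = 1`, `R = 2`, `θ′ = ½`). [folklore] -/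
theorem smoothHalfChart_thin₂ :
    SmoothHalfChart (ℝ × ℝ) (fun g _ => φJ M g) (fun _ y => (1 / 2 : ℝ) • y)
      ((1 / 2 : ℝ) • ContinuousLinearMap.id ℝ (ℝ × ℝ))
      (fun g _ => 1 + 3 * Real.log M * g ^ 2) (fun _ _ => 0) (fun _ _ => 0)
      (fun _ _ => (1 / 2 : ℝ) • ContinuousLinearMap.id ℝ (ℝ × ℝ))
      (1 * Real.log M) 1 1 2 (1 / 2) where
  δ_pos := one_pos
  δ_le_R := by norm_num
  C_nonneg := zero_le_one
  θ'_nonneg := by norm_num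
  φ_zero _ _ := by simp [φJ]
  Ψ_zero_zero := smul_zero _
  hasDeriv_φ g _ _ _ := by
    have h3 : HasDerivAt (fun t : ℝ => t ^ 3) (3 * g ^ 2) g := by
      simpa using hasDerivAt_pow 3 g
    have h := (hasDerivAt_id g).add (h3.const_mul (Real.log M))
    have e : (1 : ℝ) + Real.log M * (3 * g ^ 2) = 1 + 3 * Real.log M * g ^ 2 := by ring
    rw [e] at h
    exact h.hasDerivWithinAt
  hasFDeriv_φ _ _ _ _ := hasFDerivWithinAt_const _ _ _
  hasDeriv_Ψ _ _ y _ := hasDerivWithinAt_const _ _ _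
  hasFDeriv_Ψ _ _ _ _ := ((1 / 2 : ℝ) • ContinuousLinearMap.id ℝ (ℝ × ℝ)).hasFDerivWithinAt
  φg_bound g hg y _ := by
    have : (1 + 3 * Real.log M * g ^ 2) - (1 + 3 * (1 * Real.log M) * g ^ 2) = 0 := by ring
    rw [this, abs_zero]
    have := hg.1
    positivity
  φy_bound g hg _ _ := by rw [norm_zero]; have := hg.1; positivity
  Ψg_bound g hg y _ := by rw [norm_zero]; have := hg.1; positivity
  Ψy_sub_A g hg y _ := by rw [sub_self, norm_zero]; have := hg.1; positivity
  Ψy_bound _ _ _ _ := norm_half_id_le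

/-- **The over-tuned thin inhabitant of the line's object.** Under the same RG-free hypothesis (uniform
over-tuned triviality at some slope `B > 0`), for odd `M ≥ 2` the perfect-action regulator chart
`RegulatorChart G r M` of line `perfect-action-regulator-chart` — smooth half-chart normal form, Wilson arc,
dictionary, curvature chart functions with inside-chart covariance, arc identification and chart continuity —
is inhabited by the thin polynomial maps on `E = ℝ × ℝ` and the pure-curvature restriction of `expectC`:
no regulator, no polymer norm, no perfect action. So the line's load-bearing stub `stub_regulatorChartOdd`
asks for no more than over-tuned triviality. [folklore] -/
theorem nonempty_regulatorChart_of_uniformOverTuned (hMo : Odd M) (hM : 2 ≤ M) {B : ℝ} (hB : 0 < B)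
    (hUOT : ∀ (B' : ℝ) (L m : ℕ) (h : Fin (m + 1) → 𝓢(EuclideanSpace ℝ (Fin 4), ℝ)),
      IsOffDiagonal (SchwartzMap.tensorFin (m + 1) fun i => ofRealTest (h i)) →
      ∀ ε > 0, ∃ k₀ : ℕ, ∀ k ≥ k₀, ∀ β : ℝ, B * k - B' ≤ β →
        |wilsonCentredSchwinger r.ρ β ((M ^ k * (2 * L + 1) - 1) / 2) (fun _ => 1) (m + 1)
          (fun _ => r.curvature) (fun i => (blockDilate M)^[k] (h i))| ≤ ε) :
    Nonempty (RegulatorChart G r M) := by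
  have hlog : 0 < Real.log M := Real.log_pos (by exact_mod_cast hM)
  have hκ : 0 < B / Real.log M := div_pos hB hlog
  refine ⟨{
    two_le_M := hM
    E := ℝ × ℝ
    φ := fun g _ => φJ M g
    Ψ := fun _ y => (1 / 2 : ℝ) • y
    A := (1 / 2 : ℝ) • ContinuousLinearMap.id ℝ (ℝ × ℝ)
    φg := fun g _ => 1 + 3 * Real.log M * g ^ 2
    φy := fun _ _ => 0
    Ψg := fun _ _ => 0
    Ψy := fun _ _ => (1 / 2 : ℝ) • ContinuousLinearMap.id ℝ (ℝ × ℝ)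
    b₀ := 1
    θ := 1 / 2
    C := 1
    δ := 1
    R := 2
    θ' := 1 / 2
    b₀_pos := one_pos
    θ_nonneg := by norm_num
    θ_lt_one := by norm_num
    norm_A_le := norm_half_id_le
    θ'_lt_one := by norm_num
    smooth := smoothHalfChart_thin₂ M
    yW := fun g => ((1 : ℝ), g)
    g₀ := 1
    betaOf := fun g => B / Real.log M / g ^ 2
    κ := B / Real.log M
    K := 0
    corr := fun p S n f => expectC r M (B / Real.log M) hM n (fun _ => r.curvature) p S f
    realisation := {
      g₀_pos := one_pos
      g₀_le_δ := le_rfl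
      continuousOn_yW := by fun_prop
      norm_yW_le := fun g hg => by
        rw [Prod.norm_def, Real.norm_eq_abs, Real.norm_eq_abs, abs_one, abs_of_nonneg hg.1]
        exact max_le (by norm_num) (hg.2.trans (by norm_num))
      strictAntiOn_betaOf := by
        intro t ht t' ht' hlt
        simp only
        rw [div_lt_div_iff_of_pos_left hκ (by have := ht'.1; positivity) (by have := ht.1; positivity)]
        exact pow_lt_pow_left₀ hlt ht.1.le two_ne_zero
      continuousOn_betaOf := by
        refine continuousOn_of_forall_continuousAt fun t ht => ?_
        have : t ^ 2 ≠ 0 := by have := ht.1; positivity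
        fun_prop (disch := assumption)
      κ_pos := hκ
      betaOf_sub_le := fun g _ => by simp
      corr_step := fun g y _ _ _ _ S n f => expectC_step r M _ hM n _ (g, y) S f
      corr_wilson := fun g hg L n f => by
        change expectC r M (B / Real.log M) hM n (fun _ => r.curvature) (g, ((1 : ℝ), g)) (2 * L + 1) f = _
        rw [expectC_wilson r M _ hM hMo n _ hg L f, wilsonCentredSchwinger_cInd, if_pos fun _ => rfl]
      corr_continuousOn := fun S n f hf =>
        (continuous_expectC r M hM hB hUOT n _ S f hf).continuousOn } }⟩

end Inhabitant

end

end Summit.QuantumFields.YangMills.Theorems.BalabanStepParabolic.Negative
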